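import Summits.NavierStokesRegularity.NavierStokesRegularity.Theorems.RellichScarSymmetricScarExistsRdssRobustSlowScrew
import Summits.NavierStokesRegularity.NavierStokesRegularity.Theorems.RellichScarSymmetricScarExistsRdssCalibrations
import Summits.NavierStokesRegularity.NavierStokesRegularity.Theorems.RellichScarSymmetricScarExistsSmallConstant
import Summits.NavierStokesRegularity.NavierStokesRegularity.Theorems.RellichScarSymmetricScarExistsDilationContinuity
import Summits.NavierStokesRegularity.NavierStokesRegularity.Theorems.RellichScarSymmetricScarExistsIrrationalRotationApexFatal
import Summits.NavierStokesRegularity.NavierStokesRegularity.Theorems.RellichScarSymmetricScarExistsRotInvariantLimit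

/-!
# Crux `SymmetricScarExists` (stmt-NavierStokesRegularity-11718), line `rdss-screw-split` — the lead's assembly (c4):
# every screw DIRECTION is fatal near the identity

Support file of the line lead (`--supports stmt-NavierStokesRegularity-11718`; registered by-product
`rdssApexFatal_anyAngle_nearOne`).  Child C of the RDSS screw split (the wall: no singular apex Type-I profile is
a.e. fixed on the slab by a screw-dilation `x ↦ c R_θ x`, `c > 1`) is open in the middle of the screw group
`ℝ₊ × SO(2)`; its landed corners near the identity are the Pineau–Vicol cones `|θ| ≲ log c` and the rational
directions `qθ ∈ 2πℤ`, `c^q < c₁` (Chae–Wolf).  This file closes EVERY direction near the identity in the classes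
`𝐈 ≤ I < ⊤`:

* `rdssApexFatal_irrationalAngle_nearOne` (T4): for `θ/2π ∉ ℚ` there is `c⋆(C, I, θ) > 1` with no a.e.
  `(c, θ)`-invariant singular apex profile for `1 < c < c⋆` — otherwise factors `c_k ↓ 1` carry such profiles, a
  subsequence converges in `L³_loc` (`Robust.slabLimit_le`, Albritton–Barker compactness) to a singular apex
  profile `u`, the dilations `D_{c_k} u → u` (`stub_dilationContinuity`), so `u` is a.e. fixed by the PURE ROTATION
  `R_θ` (`stub_rotInvariantLimit`), which is impossible for an irrational angle (`stub_irrationalRotationApexFatal`: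
  closed stabiliser ⇒ axisymmetry ⇒ Seregin–Šverák);
* `rdssApexFatal_anyAngle_nearOne` (T5): every angle — rational directions by the landed rational corner
  `Calibration.rdssApexFatal_rationalAngle_nearOne` with `c⋆ = c₁^{1/q}`;
* `rdssInvariant_pow`: a.e. screw invariance passes to powers `(cⁿ, nθ)`.

## References

* D. Albritton, T. Barker, *Global weak Besov solutions … and applications*, ARMA 232 (2019) = arXiv:1811.00502,
  Lemma 2.2, Prop. 2.3. [AlbrittonBarker2019]
* D. Chae, J. Wolf, *Removing discretely self-similar singularities for the 3D Navier–Stokes equations*,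
  Comm. PDE 42 (2017) = arXiv:1610.09464, Thm 1.3. [ChaeWolf2017RemovingDSS]
* G. Seregin, V. Šverák, *On Type I singularities of the local axi-symmetric solutions of the Navier–Stokes
  equations*, Comm. PDE 34 (2009), Thm 3.1. [SereginSverak2009]
-/

noncomputable section

open MeasureTheory Set Function Filter Topology TopologicalSpace Metric
open scoped NNReal ENNReal

namespace Summit.NavierStokesRegularity.NavierStokesRegularity.Theorems.SymmetricScarExists.RdssSplit.NearIdentity

set_option linter.dupNamespace false

open Literature.Analysis.FluidPDE
open Summit.NavierStokesRegularity.NavierStokesRegularity.Theses.RellichScar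
open Summit.NavierStokesRegularity.NavierStokesRegularity.Theorems.SymmetricScarExists.Negative

/-! ## The assembly

`rdssApexFatal_irrationalAngle_nearOne` (T4) composes AUX-2, AUX-3, AUX-1 with the quantitative slab
compactness `Robust.slabLimit_le`; `rdssApexFatal_anyAngle_nearOne` (T5) adds the landed rational corner
`Calibration.rdssApexFatal_rationalAngle_nearOne`.  Net: for every `C`, every `I < ⊤` and EVERY angle `θ` there
is `c⋆ = c⋆(C, I, θ) > 1` such that child C holds at the screw `(c, θ)` for all `1 < c < c⋆` in the class
`𝐈 ≤ I` — the near-identity corner of the wall in every direction of the screw group, beyond the cones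
`|θ| ≲ log c` of Pineau–Vicol and the rational directions. -/

/-- Measurability of the rescaled slab profiles on the backward balls (bookkeeping for AUX-3). [folklore] -/
theorem aestronglyMeasurable_nsRescale_slabProfile
    {u : ℝ → EuclideanSpace ℝ (Fin 3) → EuclideanSpace ℝ (Fin 3)} {p : ℝ → EuclideanSpace ℝ (Fin 3) → ℝ}
    {G : ℝ → EuclideanSpace ℝ (Fin 3) → EuclideanSpace ℝ (Fin 3) →L[ℝ] EuclideanSpace ℝ (Fin 3)}
    (hsw : IsSuitableWeakSolutionOn (slab (EuclideanSpace ℝ (Fin 3)) (Iio (0 : ℝ)) isOpen_Iio) 1 0 u p)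
    (hwg : HasWeakSpatialGradientOn (slab (EuclideanSpace ℝ (Fin 3)) (Iio (0 : ℝ)) isOpen_Iio) u G) :
    ∀ r : ℝ, 0 < r → ∀ R : ℝ, 0 < R → AEStronglyMeasurable (uncurry (nsRescale r u))
      (volume.restrict (parabolicCylinder R (0 : ℝ × EuclideanSpace ℝ (Fin 3)))) := by
  intro r hr R _
  rw [Summit.NavierStokesRegularity.NavierStokesRegularity.Theorems.nsRescale_eq_zoom]
  exact (Summit.NavierStokesRegularity.NavierStokesRegularity.Theorems.zoom_slabProfile hsw hwg hr).2.1
    |>.locallyIntegrableOn.aestronglyMeasurable.mono_measure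
      (Measure.restrict_mono (parabolicCylinder_origin_subset_slab _) le_rfl)

/-- **Inheritance from powers**: a profile a.e. fixed by the screw `(c, θ)` (`c > 0`) is a.e. fixed by its powers
`(cⁿ, nθ)`; so fatality of `(cⁿ, nθ)` in some class implies fatality of `(c, θ)` in the same class. [folklore] -/
theorem rdssInvariant_pow {u : ℝ → EuclideanSpace ℝ (Fin 3) → EuclideanSpace ℝ (Fin 3)} {c θ : ℝ} (hc : 0 < c)
    (h : uncurry (fun t x => rotZ θ (nsRescale c u t (rotZ (-θ) x)))
      =ᵐ[volume.restrict (Iio (0 : ℝ) ×ˢ (univ : Set (EuclideanSpace ℝ (Fin 3))))] uncurry u) (n : ℕ) :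
    uncurry (fun t x => rotZ ((n : ℝ) * θ) (nsRescale (c ^ n) u t (rotZ (-((n : ℝ) * θ)) x)))
      =ᵐ[volume.restrict (Iio (0 : ℝ) ×ˢ (univ : Set (EuclideanSpace ℝ (Fin 3))))] uncurry u :=
  Summit.NavierStokesRegularity.NavierStokesRegularity.Theorems.SymmetricScarExists.RdssSplit.Calibration.ae_screw_pow hc h n

/-- **T4 — an IRRATIONAL screw direction is fatal near the identity.**  For every `C`, every `I < ⊤` and every
angle `θ` with `θ/2π ∉ ℚ` there is `c⋆ > 1` such that no suitable weak solution on the slab with a weak gradient,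
`𝐈 ≤ I`, the apex bound of constant `C` and a singular origin is a.e. fixed by the screw `(c, θ)` with
`1 < c < c⋆`.  Otherwise factors `c_k ↓ 1` carry such profiles `v_k`; a subsequence converges in `L³_loc`
(`slabLimit_le`) to a singular apex profile `u`, the dilations `D_{c_k} u → u` (AUX-2), so `u` is a.e. fixed by
the pure rotation `R_θ` (AUX-3), which AUX-1 forbids. [folklore] -/
theorem rdssApexFatal_irrationalAngle_nearOne :
    ∀ (C : ℝ) (I : ℝ≥0∞) (θ : ℝ), I < ⊤ → Irrational (θ / (2 * Real.pi)) →
      ∃ cstar : ℝ, 1 < cstar ∧ ∀ c : ℝ, 1 < c → c < cstar →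
        ∀ (u : ℝ → EuclideanSpace ℝ (Fin 3) → EuclideanSpace ℝ (Fin 3)) (p : ℝ → EuclideanSpace ℝ (Fin 3) → ℝ)
          (G : ℝ → EuclideanSpace ℝ (Fin 3) → EuclideanSpace ℝ (Fin 3) →L[ℝ] EuclideanSpace ℝ (Fin 3)),
          IsSuitableWeakSolutionOn (slab (EuclideanSpace ℝ (Fin 3)) (Iio (0 : ℝ)) isOpen_Iio) 1 0 u p →
          HasWeakSpatialGradientOn (slab (EuclideanSpace ℝ (Fin 3)) (Iio (0 : ℝ)) isOpen_Iio) u G →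
          typeIBound (Iio (0 : ℝ) ×ˢ univ) u p G ≤ I → HasTypeIDecay C u → IsBackwardSingularPoint u 0 →
          uncurry (fun t x => rotZ θ (nsRescale c u t (rotZ (-θ) x)))
            =ᵐ[volume.restrict (Iio (0 : ℝ) ×ˢ (univ : Set (EuclideanSpace ℝ (Fin 3))))] uncurry u → False := by
  intro C I θ hI hirr
  rcases lt_or_ge C 0 with hC | hC
  · -- a negative constant: the class is empty
    refine ⟨2, one_lt_two, fun c _ _ u p G _ _ _ hdec _ _ => ?_⟩
    have h := hdec (-1) (by norm_num) 0
    rw [norm_zero, neg_neg, Real.sqrt_one, zero_add, div_one] at h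
    linarith [norm_nonneg (u (-1) 0)]
  by_contra hcon
  push Not at hcon
  have hpos : ∀ k : ℕ, (1 : ℝ) < 1 + 1 / ((k : ℝ) + 1) := fun k => by
    have : (0 : ℝ) < 1 / ((k : ℝ) + 1) := by positivity
    linarith
  choose c hc1 hck v q H hsw hwg hIk hdec hsing hinv using fun k : ℕ => hcon _ (hpos k)
  have hc0 : ∀ k, 0 < c k := fun k => one_pos.trans (hc1 k)
  -- `c_k → 1`
  have hc_tend : Tendsto c atTop (𝓝 1) := by
    have h1 : Tendsto (fun k : ℕ => (1 : ℝ) + 1 / ((k : ℝ) + 1)) atTop (𝓝 1) := by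
      have h := (tendsto_one_div_add_atTop_nhds_zero_nat).const_add (1 : ℝ)
      rwa [add_zero] at h
    exact tendsto_of_tendsto_of_tendsto_of_le_of_le tendsto_const_nhds h1 (fun k => (hc1 k).le)
      (fun k => (hck k).le)
  -- ## compactness: a singular apex `L³_loc` limit along `φ`
  obtain ⟨u, p, G, φ, hφ, hswu, hwgu, hIu, hdecu, hsingu, hconv⟩ :=
    Summit.NavierStokesRegularity.NavierStokesRegularity.Theorems.SymmetricScarExists.RdssSplit.Robust.slabLimit_le
      C I v q H hC hI (fun k => ⟨hsw k, hwg k, hIk k, hdec k, hsing k⟩)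
  have hI4 : 4 * I < ⊤ := ENNReal.mul_lt_top (by simp) hI
  have hIu' : typeIBound (Iio (0 : ℝ) ×ˢ univ) u p G < ⊤ := lt_of_le_of_lt hIu hI4
  -- ## AUX-2: the dilations `D_{c_{φ j}} u → u` in every `L³(Q(0,R))`
  have hmem : ∀ R : ℝ, 0 < R → MemLp (uncurry u) 3
      (volume.restrict (parabolicCylinder R (0 : ℝ × EuclideanSpace ℝ (Fin 3)))) :=
    fun R hR => Summit.NavierStokesRegularity.NavierStokesRegularity.Theorems.memLp_three_of_slabProfile hwgu hIu' hR
  have hcφ0 : ∀ j : ℕ, 0 < c (φ j) := fun j => hc0 (φ j)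
  have hcφ : Tendsto (fun j => c (φ j)) atTop (𝓝 1) := hc_tend.comp hφ.tendsto_atTop
  have hdil := stub_dilationContinuity u hmem (fun j => c (φ j)) hcφ0 hcφ
  -- ## AUX-3: the limit is a.e. fixed by the pure rotation `R_θ`
  have hVm : ∀ (j : ℕ) (r : ℝ), 0 < r → ∀ R : ℝ, 0 < R →
      AEStronglyMeasurable (uncurry (nsRescale r (v (φ j))))
        (volume.restrict (parabolicCylinder R (0 : ℝ × EuclideanSpace ℝ (Fin 3)))) :=
    fun j => aestronglyMeasurable_nsRescale_slabProfile (hsw (φ j)) (hwg (φ j))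
  have hum := aestronglyMeasurable_nsRescale_slabProfile hswu hwgu
  have hrot := stub_rotInvariantLimit θ (fun j => c (φ j)) (fun j => v (φ j)) u hcφ0 hcφ hVm hum hconv hdil
    (fun j => (hinv (φ j)).1)
  -- ## AUX-1: an irrationally rotation-invariant singular apex profile does not exist
  exact stub_irrationalRotationApexFatal u p G C θ hswu hwgu hIu' hdecu hsingu hirr hrot

/-- **T5 — EVERY screw direction is fatal near the identity.**  For every `C`, every `I < ⊤` and every angle
`θ` there is `c⋆ > 1` such that child C holds at `(c, θ)` for `1 < c < c⋆` in the class `𝐈 ≤ I`: irrational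
directions by T4; a rational direction `θ/2π = m/q` by the landed rational corner (the `q`-th power of the screw
is the untwisted dilation by `c^q < c₁`, Chae–Wolf), with `c⋆ = c₁^{1/q}`. [cite: ChaeWolf2017RemovingDSS, Theorem 1.3 (arXiv:1610.09464 p. 3)] -/
theorem rdssApexFatal_anyAngle_nearOne :
    ∀ (C : ℝ) (I : ENNReal) (θ : ℝ), I < ⊤ → ∃ cstar : ℝ, 1 < cstar ∧ ∀ c : ℝ, 1 < c → c < cstar → ∀ (u : ℝ → EuclideanSpace ℝ (Fin 3) → EuclideanSpace ℝ (Fin 3)) (p : ℝ → EuclideanSpace ℝ (Fin 3) → ℝ) (G : ℝ → EuclideanSpace ℝ (Fin 3) → EuclideanSpace ℝ (Fin 3) →L[ℝ] EuclideanSpace ℝ (Fin 3)), Literature.Analysis.FluidPDE.IsSuitableWeakSolutionOn (Literature.Analysis.FluidPDE.slab (EuclideanSpace ℝ (Fin 3)) (Set.Iio 0) isOpen_Iio) 1 0 u p → Literature.Analysis.FluidPDE.HasWeakSpatialGradientOn (Literature.Analysis.FluidPDE.slab (EuclideanSpace ℝ (Fin 3)) (Set.Iio 0) isOpen_Iio)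 u G → Literature.Analysis.FluidPDE.typeIBound (Set.Iio (0 : ℝ) ×ˢ Set.univ) u p G ≤ I → Literature.Analysis.FluidPDE.HasTypeIDecay C u → Literature.Analysis.FluidPDE.IsBackwardSingularPoint u 0 → Function.uncurry (fun t x => Literature.Analysis.FluidPDE.rotZ θ (Literature.Analysis.FluidPDE.nsRescale c u t (Literature.Analysis.FluidPDE.rotZ (-θ) x))) =ᵐ[MeasureTheory.volume.restrict (Set.Iio (0 : ℝ) ×ˢ Set.univ)] Function.uncurry u → False := by
  intro C I θ hI
  by_cases hirr : Irrational (θ / (2 * Real.pi))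
  · exact rdssApexFatal_irrationalAngle_nearOne C I θ hI hirr
  rcases le_or_gt C 0 with hC | hC
  · -- a nonpositive constant: the field vanishes on the slab, the origin is not singular
    refine ⟨2, one_lt_two, fun c _ _ u p G _ _ _ hdec hsing _ => ?_⟩
    refine Summit.NavierStokesRegularity.NavierStokesRegularity.Theorems.SymmetricScarExists.ScarWindow.not_isBackwardSingularPoint_of_ae_zero_slab (u := u) ?_ hsing
    filter_upwards [ae_restrict_mem (measurableSet_Iio.prod MeasurableSet.univ)] with w hw
    exact Summit.NavierStokesRegularity.NavierStokesRegularity.Theorems.SymmetricScarExists.ScarWindow.eq_zero_of_hasTypeIDecay_nonpos hC hdec hw.1 w.2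
  -- a rational direction `θ / 2π = r`
  unfold Irrational at hirr
  push Not at hirr
  obtain ⟨r, hr⟩ := hirr
  obtain ⟨c₁, hc₁, Hrat⟩ :=
    Summit.NavierStokesRegularity.NavierStokesRegularity.Theorems.SymmetricScarExists.RdssSplit.Calibration.rdssApexFatal_rationalAngle_nearOne C hC
  have hden : (0 : ℝ) < r.den := by exact_mod_cast r.den_pos
  have hqθ : (r.den : ℝ) * θ = 2 * Real.pi * r.num := by
    have hπ : (2 * Real.pi) ≠ 0 := by positivity
    have e : θ = 2 * Real.pi * (r : ℝ) := by
      rw [hr]; field_simp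
    rw [e, Rat.cast_def]
    field_simp
  refine ⟨c₁ ^ (1 / (r.den : ℝ)), Real.one_lt_rpow hc₁ (by positivity), fun c hc hcc u p G hsw hwg hIle hdec hsing hinv => ?_⟩
  have hcq : c ^ r.den < c₁ := by
    have h1 : c ^ r.den < (c₁ ^ (1 / (r.den : ℝ))) ^ r.den :=
      pow_lt_pow_left₀ hcc (zero_le_one.trans hc.le) r.den_pos.ne'
    have h2 : (c₁ ^ (1 / (r.den : ℝ))) ^ r.den = c₁ := by
      rw [← Real.rpow_natCast, ← Real.rpow_mul (zero_le_one.trans hc₁.le), one_div_mul_cancel hden.ne',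
        Real.rpow_one]
    rwa [h2] at h1
  exact Hrat c θ r.den r.num r.den_pos hqθ hc hcq u p G hsw hwg (lt_of_le_of_lt hIle hI) hdec hsing hinv


end Summit.NavierStokesRegularity.NavierStokesRegularity.Theorems.SymmetricScarExists.RdssSplit.NearIdentity

end
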